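import Literature.Barriers.Parity.SiegelZeroDichotomyPairHL
import HarnessLib

/-!
# Heath-Brown's theorem: a Siegel zero forces the Hardy–Littlewood asymptotic for prime pairs
# (Heath-Brown 1983, Theorem 1, in the quality form of Tao–Teräväinen 2022, Theorem 1.5 (i))

Statement layer for the «illusory world» column, topic «twin primes / prime pairs». The primary
source — D. R. Heath-Brown, *Prime twins and Siegel zeros*, Proc. London Math. Soc. (3) 47 (1983)
193–224 [Heathbrown1983] — is not held (acq-00505, cite-only); its Theorem 1 is typed here EXACTLY
as restated, with attribution "[11, Theorem 1]", in the held refereed source T. Tao, J. Teräväinen,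
*The Hardy–Littlewood–Chowla conjecture in the presence of a Siegel zero*, J. London Math. Soc. (2)
106 (2022) 3317–3378 = arXiv:2109.06291 [TaoTeravainen2021], §1 Theorem 1.5 (i) (p. 3 of the held
copy), in Tao–Teräväinen's normalisation (Definition 1.4: Siegel zero of quality `η`; (1.1): the
singular series `𝔖`; `𝔼_{n ≤ x}` the average over `1 ≤ n ≤ x`).

## What the source prints ([TaoTeravainen2021], §1)

"There are prior results in the literature towards Conjecture 1.3 in the presence of a Siegel zero
… due to Heath-Brown [11] in the case of two-point correlations of the von Mangoldt function …
**Theorem 1.5** (Prior results on Hardy–Littlewood–Chowla given a Siegel zero). Suppose that one has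
a Siegel zero `β` with associated conductor `q_χ` and quality `η`.
(i) [11, Theorem 1] For any distinct fixed natural numbers `h₁, h₂`, one has
`𝔼_{n ≤ x} Λ(n + h₁) Λ(n + h₂) = 𝔖 + O(1/log log η)` uniformly for all `q_χ^{250} ≤ x ≤ q_χ^{300}`,
where `𝔖` is defined by (1.1)." (§2.1: implied constants may depend on the fixed quantities
`h₁, h₂` and may be ineffective; "We will also assume that `η` is sufficiently large depending on
the fixed quantities".) Parts (ii) [Germán–Kátai] and (iii) [Chinis] of Theorem 1.5 concern the
Liouville function (the tree types Chinis's theorem in `SiegelZerosChowlaSubsequence.lean`).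

## Contents

* `heathBrown1983_theorem1` — NAMED FACT: Heath-Brown's Theorem 1 AS RESTATED in
  [TaoTeravainen2021, Theorem 1.5 (i)], on the tree's `IsSiegelZero`, `vonMangoldtPairAverage`
  (`𝔼_{n ≤ x} Λ(n+h₁)Λ(n+h₂)`, `SiegelZeroDichotomyPairHL.lean`) and
  `Literature.NumberTheory.Sieve.singularSeries` ((1.1)); "`η` sufficiently large" and the `O`-constant
  as `∃ η₀ C` depending on `h₁, h₂`; shifts `h₁ ≠ h₂` with `hᵢ ≥ 1` (as in the tree's typing of
  Corollary 1.8 (i), `TaoTeravainen2021_pairHL`).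
* PROVED: `SiegelZeroTwinPrimes_of_heathBrown1983` — the barrier record
  `Literature.Barriers.Parity.SiegelZeroTwinPrimes` (`UnboundedSiegelZeros → TwinPrimeConjecture`)
  DIRECTLY from Heath-Brown's theorem (the tree derives it from Tao–Teräväinen's Corollary 1.8 (i),
  `SiegelZeroTwinPrimes_of_pairHL`, and from Matomäki–Merikoski's Corollary 1.1,
  `SiegelZeroTwinPrimes_of_matomakiMerikoski`): at `x = q^{250}` the pair sum with shifts `(1, 3)`
  is `≥ (2C₂ − o(1)) x`, impossible if there are no twin primes above some `n₀`
  (`pairSum_le_of_noTwinAbove`, `eventually_pairSumBound_le`, `pairSum_one_three_le` of the tree);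
  and the no-go `not_twinPrime_bounds_siegelZeros_of_heathBrown1983`.

LABEL: instrument / statement layer. WHAT THIS IS NOT: no claim that Siegel zeros exist; the twin
prime conjecture is not advanced; Heath-Brown's own wording, constants and Theorem 2 were not read
(primary not held) — only Tao–Teräväinen's restatement of Theorem 1 is vouched for here.

## References

* [Heathbrown1983] D. R. Heath-Brown, *Prime twins and Siegel zeros*, Proc. London Math. Soc. (3)
  47 (1983), no. 2, 193–224, Theorem 1 (as restated in [TaoTeravainen2021, Theorem 1.5 (i)]; primary
  not held, acq-00505).
* [TaoTeravainen2021] T. Tao, J. Teräväinen, J. London Math. Soc. (2) 106 (2022) 3317–3378 =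
  arXiv:2109.06291: §1 Definition 1.4, (1.1), Theorem 1.5 (i), §2.1 (conventions).
-/

noncomputable section

open Finset Filter Topology Real
open scoped ArithmeticFunction.vonMangoldt
open Literature.Barriers.Parity

namespace Literature.NumberTheory.LFunctions

/-- **Heath-Brown 1983, Theorem 1, as restated by Tao–Teräväinen (Theorem 1.5 (i))** (NAMED FACT):
for distinct shifts `h₁, h₂ ≥ 1` there are `η₀` and `C` such that for every Siegel zero of quality
`η ≥ η₀` attached to `χ` mod `q` (Tao–Teräväinen Definition 1.4) and every `q^{250} ≤ x ≤ q^{300}`,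
`|𝔼_{n ≤ x} Λ(n+h₁)Λ(n+h₂) − 𝔖({h₁,h₂})| ≤ C/log log η`. Not proved here.
[cite: Heathbrown1983, Theorem 1 (as restated in Tao–Teräväinen 2022, Theorem 1.5 (i))]
[cite: TaoTeravainen2021, Theorem 1.5 (i) with Definition 1.4, (1.1) and §2.1] -/
def heathBrown1983_theorem1 : Prop :=
  ∀ h₁ h₂ : ℕ, 1 ≤ h₁ → 1 ≤ h₂ → h₁ ≠ h₂ →
    ∃ (η₀ C : ℝ), ∀ (q : ℕ) [NeZero q] (χ : DirichletCharacter ℂ q) (η : ℝ), IsSiegelZero χ η →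
      η₀ ≤ η → ∀ x : ℕ, (q : ℝ) ^ (250 : ℝ) ≤ x → (x : ℝ) ≤ (q : ℝ) ^ (300 : ℝ) →
        |vonMangoldtPairAverage h₁ h₂ x -
            Literature.NumberTheory.Sieve.singularSeries ({(h₁ : ℤ), (h₂ : ℤ)} : Finset ℤ)| ≤
          C / Real.log (Real.log η)

/-- **The Siegel-zero dichotomy from Heath-Brown's theorem itself** (PROVED modulo
`heathBrown1983_theorem1`): Siegel zeros of unbounded quality imply the twin prime conjecture — the
barrier record `Literature.Barriers.Parity.SiegelZeroTwinPrimes`. With shifts `(1, 3)` (so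
`𝔖 = 2C₂ > 0`) at `x = q^{250}`: the average `𝔼_{n ≤ x} Λ(n+1)Λ(n+3)` exceeds `C₂` once
`C/log log η < C₂`, while without twin primes above `n₀` the pair sum is `o(x)`.
[cite: TaoTeravainen2021, Theorem 1.5 (i)] [cite: Heathbrown1983, Theorem 1 (as restated in Tao–Teräväinen 2022, Theorem 1.5 (i))] -/
theorem SiegelZeroTwinPrimes_of_heathBrown1983 (hHB : heathBrown1983_theorem1) :
    SiegelZeroTwinPrimes := by
  intro hU
  by_contra hno
  -- no twin primes above `n₀`
  have hno' : ∃ n₀ : ℕ, ∀ p : ℕ, n₀ < p → ¬ (p.Prime ∧ (p + 2).Prime) := by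
    unfold Literature.NumberTheory.Sieve.TwinPrimeConjecture at hno
    simp only [not_forall, not_exists, not_and] at hno
    obtain ⟨n₀, hn₀⟩ := hno
    exact ⟨n₀, fun p hp h => hn₀ p hp h.1 h.2⟩
  obtain ⟨n₀, hn₀⟩ := hno'
  -- the constants
  set c : ℝ := Literature.NumberTheory.Sieve.twinPrimeConst with hc_def
  have hc : 0 < c := Literature.NumberTheory.Sieve.twinPrimeConst_pos_holds
  obtain ⟨η₀, C, hC⟩ := hHB 1 3 le_rfl (by norm_num) (by norm_num)
  -- `C / log log η < c` for `η ≥ η₁`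
  have hlim : Tendsto (fun η : ℝ => C / Real.log (Real.log η)) atTop (𝓝 0) :=
    tendsto_const_nhds.div_atTop (Real.tendsto_log_atTop.comp Real.tendsto_log_atTop)
  obtain ⟨η₁, hη₁⟩ := eventually_atTop.mp (hlim.eventually (gt_mem_nhds hc))
  -- the pair-sum bound is `≤ (c/2) X` for `X ≥ X₁`
  obtain ⟨X₁, hX₁⟩ := eventually_atTop.mp (eventually_pairSumBound_le n₀ (half_pos hc))
  -- a Siegel zero of quality `≥ max η₀ η₁` at a conductor `≥ max ⌈X₁⌉₊ 2`
  obtain ⟨q, inst, χ, η, hq, hη, hS⟩ := hU (max η₀ η₁) (max ⌈X₁⌉₊ 2)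
  have hη₀η : η₀ ≤ η := le_of_max_le_left hη
  have hη₁η : η₁ ≤ η := le_of_max_le_right hη
  have hq2 : 2 ≤ q := le_of_max_le_right hq
  have hqX : ⌈X₁⌉₊ ≤ q := le_of_max_le_left hq
  have hq1' : (1 : ℝ) ≤ q := by exact_mod_cast (show 1 ≤ q by omega)
  -- the scale `x = q^{250}`
  set x : ℕ := q ^ 250 with hx_def
  have hxcast : (x : ℝ) = (q : ℝ) ^ (250 : ℝ) := by
    rw [hx_def, Nat.cast_pow, show (250 : ℝ) = ((250 : ℕ) : ℝ) by norm_num, Real.rpow_natCast]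
  have hx1 : 1 ≤ x := Nat.one_le_pow _ _ (by omega)
  have hxq : q ≤ x := by
    calc q = q ^ 1 := (pow_one q).symm
      _ ≤ q ^ 250 := Nat.pow_le_pow_right (by omega) (by norm_num)
  have hxpos : (0 : ℝ) < x := by exact_mod_cast (show 0 < x by omega)
  -- `x` lies in Heath-Brown's window
  have hlow : (q : ℝ) ^ (250 : ℝ) ≤ x := by rw [hxcast]
  have hup : (x : ℝ) ≤ (q : ℝ) ^ (300 : ℝ) := by
    rw [hxcast]
    exact Real.rpow_le_rpow_of_exponent_le hq1' (by norm_num)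
  -- Heath-Brown's theorem at this scale
  have havg := hC q χ η hS hη₀η x hlow hup
  rw [show (((1 : ℕ) : ℤ)) = 1 by norm_num, show (((3 : ℕ) : ℤ)) = 3 by norm_num,
    singularSeries_pair_one_three] at havg
  have hsmall : C / Real.log (Real.log η) < c := hη₁ η hη₁η
  -- hence the pair sum with shifts `(1, 3)` exceeds `c x`
  have hbig : c * x < ∑ n ∈ Icc 1 x, Λ (n + 1) * Λ (n + 3) := by
    have h1 : c < vonMangoldtPairAverage 1 3 x := by
      have := abs_sub_lt_iff.mp (lt_of_le_of_lt havg hsmall)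
      rw [← hc_def] at this
      linarith [this.1, this.2]
    unfold vonMangoldtPairAverage at h1
    rwa [lt_div_iff₀ hxpos] at h1
  -- but without twin primes above `n₀` it is `≤ (c/2)(x+1) ≤ c x`
  have hX₁x : X₁ ≤ ((x + 1 : ℕ) : ℝ) := by
    have h1 : X₁ ≤ (⌈X₁⌉₊ : ℝ) := Nat.le_ceil X₁
    have h2 : (⌈X₁⌉₊ : ℝ) ≤ q := by exact_mod_cast hqX
    have h3 : (q : ℝ) ≤ ((x + 1 : ℕ) : ℝ) := by exact_mod_cast (hxq.trans (Nat.le_succ x))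
    linarith
  have hbound := hX₁ ((x + 1 : ℕ) : ℝ) hX₁x
  rw [Nat.floor_natCast] at hbound
  have hpair := (pairSum_le_of_noTwinAbove hn₀ (x + 1)).trans hbound
  have hshift := pairSum_one_three_le x
  have hx1' : (1 : ℝ) ≤ x := by exact_mod_cast hx1
  push_cast at hpair
  nlinarith

/-- The no-go for disproofs, modulo Heath-Brown's theorem: if the twin prime conjecture fails, the
quality of Siegel zeros is bounded at large conductors ("at least one of (a) no Siegel zeros,
(b) infinitely many prime twins"). [cite: TaoTeravainen2021, Theorem 1.5 (i) and (1.4)]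
[cite: Heathbrown1983, Theorem 1 (as restated in Tao–Teräväinen 2022, Theorem 1.5 (i))] -/
theorem not_twinPrime_bounds_siegelZeros_of_heathBrown1983 (hHB : heathBrown1983_theorem1)
    (hno : ¬ Literature.NumberTheory.Sieve.TwinPrimeConjecture) :
    ∃ η₀ : ℝ, ∃ q₀ : ℕ, ∀ (q : ℕ) [NeZero q] (χ : DirichletCharacter ℂ q) (η : ℝ),
      q₀ ≤ q → IsSiegelZero χ η → η < η₀ :=
  (SiegelZeroTwinPrimes_of_heathBrown1983 hHB).disproof_bounds_quality hno

end Literature.NumberTheory.LFunctions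

end
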